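import Mathlib
import Summits.AtomisticToContinuum.HydrodynamicLimit.Theorems.OneSphereInfluenceStaticScoreResponseLogPartitionDeriv
import Literature.MathematicalPhysics.KineticTheory.HardSphereEulerLLN
import HarnessLib

/-!
# `StaticScoreResponse` (support item stmt-AtomisticToContinuum-12269): the canonical means and the
# tree's law of large numbers; uniform low-density smallness

Bridges between the configurational canonical Gibbs measure `posGibbsMeasure b ε_N (N+1)` along the
hydrodynamic scaling `ε_N = σ (N+1)^{-1/3}` and the one-point machinery of
`Literature.MathematicalPhysics.KineticTheory.HardSphereEulerLLN`:

* `mean_eq_onePt` — the canonical mean of the empirical average `(N+1)⁻¹ ∑ᵢ χ(xᵢ)` is the one-point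
  expectation `onePt (profileOf b) σ χ N 0 = M^χ/Ξ` (exchangeability, `integral_mul_efR_eq_Md`);
* `tendsto_mean` — hence it converges (`SmallDensity.tendsto_onePt`) as `N → ∞`;
* `succ_mul_pOv` — `(N+1) · p_{ε_N} = M v₁ σ³`: the smallness parameter of the cumulant bounds is
  `N`-independent;
* `exists_sigma_small` — for a bound `Mmax` on the sup of the normalised profiles there is `σ₀ > 0`
  such that every profile with `M ≤ Mmax` satisfies `SmallDensity P σ` and the cumulant smallness
  `2A²e⁴ M v₁ σ³ ≤ 1` for all `0 < σ < σ₀` (all conditions are monotone in `M v₁ σ³`);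
* `profileOf_M_le` — `M ≤ (sup b)/(inf b)` for the normalised profile of `b`.

Folklore; no definitions, no named facts.
-/

noncomputable section

namespace Summit.AtomisticToContinuum.HydrodynamicLimit.Theorems

open Finset MeasureTheory Metric Set Filter Topology
  Literature.Probability.LatticeModels Literature.MathematicalPhysics.StatisticalMechanics
  Literature.MathematicalPhysics.KineticTheory

variable {b χ : T3 → ℝ}

/-! ### Canonical means as one-point expectations -/

/-- **The canonical mean of the empirical average is the one-point expectation**:
`E_{posGibbsMeasure b ε_N (N+1)}[(N+1)⁻¹ ∑ᵢ χ(xᵢ)] = M^χ_N(N+1)/Ξ_N(N+1) = onePt (profileOf b) σ χ N 0`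
(exchangeability of the labels). [folklore] -/
theorem mean_eq_onePt (hb : Continuous b) (hb0 : ∀ x, 0 < b x) (hχ : Continuous χ) (σ : ℝ) (N : ℕ) :
    ∫ x, (((N + 1 : ℕ) : ℝ))⁻¹ * ∑ i, χ (x i) ∂posGibbsMeasure b (hsDiameter σ N) (N + 1) =
      onePt (profileOf b hb hb0) σ χ N 0 := by
  set P := profileOf b hb hb0 with hP
  set ε := hsDiameter σ N with hε
  set n := N + 1 with hn
  obtain ⟨C, -, hχC⟩ := exists_forall_abs_le_of_continuous hχ
  have hB : 0 < ∫ y, b y := integral_pos_of_continuous_pos hb hb0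
  have hBn : (∫ y, b y) ^ n ≠ 0 := pow_ne_zero n hB.ne'
  have h0 := integral_posGibbsMeasure_eq hb (fun x => (hb0 x).le) ε n (fun x => (((n : ℕ) : ℝ))⁻¹ * ∑ i, χ (x i))
  rw [h0, posPartition_eq hb hb0 ε n]
  -- rewrite the weighted integral through the product law
  have hI : ∫ x, ((((n : ℕ) : ℝ))⁻¹ * ∑ i, χ (x i)) * posWeight b ε n x =
      (∫ y, b y) ^ n * ∫ x, ((((n : ℕ) : ℝ))⁻¹ * ∑ i, χ (x i)) * efR (Ov ε) x univ ∂Measure.pi (fun _ : Fin n => P.μ) := by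
    rw [integral_pi_μ, ← integral_const_mul]
    refine integral_congr_ae (ae_of_all _ fun x => ?_)
    dsimp only
    rw [posWeight_eq hb hb0 ε n x]; ring
  rw [hI]
  -- exchangeability: every label contributes `Md`
  have hsum : ∫ x, ((((n : ℕ) : ℝ))⁻¹ * ∑ i, χ (x i)) * efR (Ov ε) x univ ∂Measure.pi (fun _ : Fin n => P.μ) =
      Md P ε n χ n := by
    have h1 : ∀ x : Fin n → T3, ((((n : ℕ) : ℝ))⁻¹ * ∑ i, χ (x i)) * efR (Ov ε) x univ =
        (((n : ℕ) : ℝ))⁻¹ * ∑ i, χ (x i) * efR (Ov ε) x univ := by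
      intro x; rw [mul_assoc, Finset.sum_mul]
    simp_rw [h1]
    rw [integral_const_mul, integral_finsetSum Finset.univ (f := fun i x => χ (x i) * efR (Ov ε) x univ)
      fun i _ => integrable_mul_efR P ε (hχ.measurable.comp (measurable_pi_apply i)) (fun x => hχC (x i))]
    rw [Finset.sum_congr rfl fun i _ => integral_mul_efR_eq_Md P ε hχ.measurable i]
    rw [Finset.sum_const, Finset.card_univ, Fintype.card_fin, nsmul_eq_mul]
    have hn0 : ((n : ℕ) : ℝ) ≠ 0 := by rw [hn]; positivity
    field_simp
  rw [hsum]
  simp only [onePt, XiN, Nat.sub_zero, ← hε, ← hn, ← hP]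
  by_cases hX : Xi P ε n n = 0
  · simp [hX]
  · field_simp

/-- **The canonical means converge** (the tree's one-point law of large numbers): under
`SmallDensity (profileOf b) σ`, `E_{posGibbsMeasure b ε_N (N+1)}[(N+1)⁻¹ ∑ᵢ χ(xᵢ)] → I(χ)`.
[folklore] -/
theorem tendsto_mean (hb : Continuous b) (hb0 : ∀ x, 0 < b x) (hχ : Continuous χ) {σ : ℝ}
    (h : SmallDensity (profileOf b hb hb0) σ) :
    Tendsto (fun N : ℕ => ∫ x, (((N + 1 : ℕ) : ℝ))⁻¹ * ∑ i, χ (x i) ∂posGibbsMeasure b (hsDiameter σ N) (N + 1))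
      atTop (𝓝 (Ilim (profileOf b hb hb0) σ χ)) := by
  obtain ⟨C, -, hχC⟩ := exists_forall_abs_le_of_continuous hχ
  have ht := h.tendsto_onePt hχ.measurable hχC 0
  refine ht.congr fun N => ?_
  exact (mean_eq_onePt hb hb0 hχ σ N).symm

/-! ### The smallness parameter along the hydrodynamic scaling -/

/-- `(N+1) · p_{ε_N} = M v₁ σ³` is independent of `N`. [folklore] -/
theorem succ_mul_pOv (P : DensityProfile) (σ : ℝ) (N : ℕ) :
    ((N + 1 : ℕ) : ℝ) * pOv P (hsDiameter σ N) = P.M * v₁ * σ ^ 3 := by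
  rw [pOv_hsDiameter, ovDensity]
  have hN : ((N + 1 : ℕ) : ℝ) ≠ 0 := by positivity
  field_simp

/-- Monotonicity of `x ↦ x / (1 - x)²` on `[0, 1)`. [folklore] -/
theorem div_one_sub_sq_mono {x y : ℝ} (hx : 0 ≤ x) (hxy : x ≤ y) (hy : y < 1) :
    x / (1 - x) ^ 2 ≤ y / (1 - y) ^ 2 := by
  have h1 : 0 < 1 - y := by linarith
  have h2 : 0 < 1 - x := by linarith
  rw [div_le_div_iff₀ (by positivity) (by positivity)]
  have h3 : (1 - y) ^ 2 ≤ (1 - x) ^ 2 := by nlinarith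
  nlinarith [mul_nonneg hx (sq_nonneg (1 - y))]

/-- **Smallness from a bound on `M`**: if the conditions hold with `Mmax` in place of `P.M` and
`P.M ≤ Mmax`, then `SmallDensity P σ`. [folklore] -/
theorem smallDensity_of_le {P : DensityProfile} {σ Mmax : ℝ} (hM : P.M ≤ Mmax) (hσ : 0 < σ) (hσ2 : σ < 1 / 2)
    (h1 : Mmax * v₁ * σ ^ 3 ≤ 1 / 2) (h2 : 2 * Real.exp 1 * (Mmax * v₁ * σ ^ 3) < 1)
    (h3 : Real.exp 1 * (2 * Real.exp 1 * (Mmax * v₁ * σ ^ 3)) / (1 - 2 * Real.exp 1 * (Mmax * v₁ * σ ^ 3)) < 1 / 2)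
    (h4 : 4 * (Real.exp 1 * (2 * Real.exp 1 * (Mmax * v₁ * σ ^ 3)) / (1 - 2 * Real.exp 1 * (Mmax * v₁ * σ ^ 3)) ^ 2) < 1) :
    SmallDensity P σ := by
  have hv := v₁_pos
  have hPM := P.M_pos
  have hσ3 : 0 < σ ^ 3 := pow_pos hσ 3
  have hov : ovDensity P σ ≤ Mmax * v₁ * σ ^ 3 := by
    unfold ovDensity
    exact mul_le_mul_of_nonneg_right (mul_le_mul_of_nonneg_right hM hv.le) hσ3.le
  have hov0 : 0 ≤ ovDensity P σ := by unfold ovDensity; positivity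
  have hθ : geomRatio P σ ≤ 2 * Real.exp 1 * (Mmax * v₁ * σ ^ 3) := by
    unfold geomRatio; exact mul_le_mul_of_nonneg_left hov (by positivity)
  have hθ0 : 0 ≤ geomRatio P σ := by unfold geomRatio; positivity
  have hθ1 : geomRatio P σ < 1 := lt_of_le_of_lt hθ h2
  -- monotonicity of `x ↦ x / (1 - x)` on `[0, 1)`
  have hmono : geomRatio P σ / (1 - geomRatio P σ) ≤
      2 * Real.exp 1 * (Mmax * v₁ * σ ^ 3) / (1 - 2 * Real.exp 1 * (Mmax * v₁ * σ ^ 3)) := by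
    rw [div_le_div_iff₀ (by linarith) (by linarith)]
    nlinarith
  refine ⟨hσ, hσ2, hov.trans h1, hθ1, ?_, ?_⟩
  · calc Real.exp 1 * geomRatio P σ / (1 - geomRatio P σ)
        = Real.exp 1 * (geomRatio P σ / (1 - geomRatio P σ)) := by ring
      _ ≤ Real.exp 1 * (2 * Real.exp 1 * (Mmax * v₁ * σ ^ 3) / (1 - 2 * Real.exp 1 * (Mmax * v₁ * σ ^ 3))) :=
          mul_le_mul_of_nonneg_left hmono (Real.exp_nonneg _)
      _ = _ := by ring
      _ < 1 / 2 := h3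
  · unfold contractionC
    calc 4 * (Real.exp 1 * geomRatio P σ / (1 - geomRatio P σ) ^ 2)
        = 4 * Real.exp 1 * (geomRatio P σ / (1 - geomRatio P σ) ^ 2) := by ring
      _ ≤ 4 * Real.exp 1 * (2 * Real.exp 1 * (Mmax * v₁ * σ ^ 3) / (1 - 2 * Real.exp 1 * (Mmax * v₁ * σ ^ 3)) ^ 2) :=
          mul_le_mul_of_nonneg_left (div_one_sub_sq_mono hθ0 hθ h2) (by positivity)
      _ = 4 * (Real.exp 1 * (2 * Real.exp 1 * (Mmax * v₁ * σ ^ 3)) / (1 - 2 * Real.exp 1 * (Mmax * v₁ * σ ^ 3)) ^ 2) := by ring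
      _ < 1 := h4

/-- **Uniform low-density smallness.** For every `Mmax > 0` there is `σ₀ > 0` such that for all
`0 < σ < σ₀` and every density profile with `M ≤ Mmax`: `SmallDensity P σ` (the hypotheses of the
tree's law of large numbers) and the cumulant smallness `2A²e⁴ · M v₁ σ³ ≤ 1` of the Kotecký–Preiss
bounds. [folklore] -/
theorem exists_sigma_small (Mmax : ℝ) :
    ∃ σ₀ : ℝ, 0 < σ₀ ∧ ∀ σ : ℝ, 0 < σ → σ < σ₀ → ∀ P : DensityProfile, P.M ≤ Mmax →
      SmallDensity P σ ∧ 2 * (2 * Real.exp (1 / 4)) ^ 2 * Real.exp 1 ^ 4 * (P.M * v₁ * σ ^ 3) ≤ 1 := by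
  have hv := v₁_pos
  -- `λ(σ) = Mmax v₁ σ³ → 0`
  have hlam : Tendsto (fun σ : ℝ => Mmax * v₁ * σ ^ 3) (𝓝 0) (𝓝 0) := by
    have h : Continuous fun σ : ℝ => Mmax * v₁ * σ ^ 3 := by fun_prop
    simpa using h.tendsto 0
  have hθ : Tendsto (fun σ : ℝ => 2 * Real.exp 1 * (Mmax * v₁ * σ ^ 3)) (𝓝 0) (𝓝 0) := by
    simpa using hlam.const_mul (2 * Real.exp 1)
  have h1θ : Tendsto (fun σ : ℝ => 1 - 2 * Real.exp 1 * (Mmax * v₁ * σ ^ 3)) (𝓝 0) (𝓝 1) := by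
    simpa using tendsto_const_nhds.sub hθ
  have hφ : Tendsto (fun σ : ℝ => Real.exp 1 * (2 * Real.exp 1 * (Mmax * v₁ * σ ^ 3)) /
      (1 - 2 * Real.exp 1 * (Mmax * v₁ * σ ^ 3))) (𝓝 0) (𝓝 0) := by
    simpa [Pi.div_def] using (hθ.const_mul (Real.exp 1)).div h1θ one_ne_zero
  have hκ : Tendsto (fun σ : ℝ => 4 * (Real.exp 1 * (2 * Real.exp 1 * (Mmax * v₁ * σ ^ 3)) /
      (1 - 2 * Real.exp 1 * (Mmax * v₁ * σ ^ 3)) ^ 2)) (𝓝 0) (𝓝 0) := by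
    have h := ((hθ.const_mul (Real.exp 1)).div (h1θ.pow 2) (by norm_num)).const_mul 4
    simpa [Pi.div_def] using h
  have hA : Tendsto (fun σ : ℝ => 2 * (2 * Real.exp (1 / 4)) ^ 2 * Real.exp 1 ^ 4 * (Mmax * v₁ * σ ^ 3))
      (𝓝 0) (𝓝 0) := by
    have := hlam.const_mul (2 * (2 * Real.exp (1 / 4)) ^ 2 * Real.exp 1 ^ 4)
    rwa [mul_zero] at this
  have hev : ∀ᶠ σ : ℝ in 𝓝 0, σ < 1 / 2 ∧ Mmax * v₁ * σ ^ 3 < 1 / 2 ∧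
      2 * Real.exp 1 * (Mmax * v₁ * σ ^ 3) < 1 ∧
      Real.exp 1 * (2 * Real.exp 1 * (Mmax * v₁ * σ ^ 3)) / (1 - 2 * Real.exp 1 * (Mmax * v₁ * σ ^ 3)) < 1 / 2 ∧
      4 * (Real.exp 1 * (2 * Real.exp 1 * (Mmax * v₁ * σ ^ 3)) / (1 - 2 * Real.exp 1 * (Mmax * v₁ * σ ^ 3)) ^ 2) < 1 ∧
      2 * (2 * Real.exp (1 / 4)) ^ 2 * Real.exp 1 ^ 4 * (Mmax * v₁ * σ ^ 3) < 1 := by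
    filter_upwards [Iio_mem_nhds (show (0 : ℝ) < 1 / 2 by norm_num),
      hlam.eventually_lt_const (show (0 : ℝ) < 1 / 2 by norm_num),
      hθ.eventually_lt_const (show (0 : ℝ) < 1 by norm_num),
      hφ.eventually_lt_const (show (0 : ℝ) < 1 / 2 by norm_num),
      hκ.eventually_lt_const (show (0 : ℝ) < 1 by norm_num),
      hA.eventually_lt_const (show (0 : ℝ) < 1 by norm_num)] with σ h1 h2 h3 h4 h5 h6
    exact ⟨h1, h2, h3, h4, h5, h6⟩
  obtain ⟨σ₀, hσ₀, hball⟩ := Metric.eventually_nhds_iff.mp hev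
  refine ⟨σ₀, hσ₀, fun σ hσ hσσ₀ P hPM => ?_⟩
  have hd : dist σ 0 < σ₀ := by rwa [Real.dist_eq, sub_zero, abs_of_pos hσ]
  obtain ⟨h1, h2, h3, h4, h5, h6⟩ := hball hd
  refine ⟨smallDensity_of_le hPM hσ h1 h2.le h3 h4 h5, ?_⟩
  have hσ3 : 0 < σ ^ 3 := pow_pos hσ 3
  have hmono : P.M * v₁ * σ ^ 3 ≤ Mmax * v₁ * σ ^ 3 :=
    mul_le_mul_of_nonneg_right (mul_le_mul_of_nonneg_right hPM hv.le) hσ3.le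
  calc 2 * (2 * Real.exp (1 / 4)) ^ 2 * Real.exp 1 ^ 4 * (P.M * v₁ * σ ^ 3)
      ≤ 2 * (2 * Real.exp (1 / 4)) ^ 2 * Real.exp 1 ^ 4 * (Mmax * v₁ * σ ^ 3) :=
        mul_le_mul_of_nonneg_left hmono (by positivity)
    _ ≤ 1 := h6.le

/-- **The sup of a normalised profile**: if `0 < m ≤ b ≤ M'` then `(profileOf b).M ≤ M'/m` (the torus
has unit volume, so `∫ b ≥ m`). [folklore] -/
theorem profileOf_M_le (hb : Continuous b) (hb0 : ∀ x, 0 < b x) {m M' : ℝ} (hm : 0 < m) (hmb : ∀ x, m ≤ b x)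
    (hbM : ∀ x, b x ≤ M') : (profileOf b hb hb0).M ≤ M' / m := by
  have hint : m ≤ ∫ y, b y := by
    calc m = ∫ _y : T3, m := by simp
      _ ≤ ∫ y, b y := integral_mono (integrable_const m) (integrable_of_continuous_T3 hb) hmb
  have hB : 0 < ∫ y, b y := integral_pos_of_continuous_pos hb hb0
  have hM' : 0 ≤ M' := (hb0 0).le.trans (hbM 0)
  refine csSup_le (Set.range_nonempty _) ?_
  rintro _ ⟨y, rfl⟩
  rw [profileOf_β]
  calc b y / ∫ y, b y ≤ M' / ∫ y, b y := div_le_div_of_nonneg_right (hbM y) hB.le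
    _ ≤ M' / m := div_le_div_of_nonneg_left hM' hm hint

end Summit.AtomisticToContinuum.HydrodynamicLimit.Theorems

end
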